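import Summits.KontsevichZagierPeriods.KontsevichZagierPeriods.Theorems.RootDecompRelativeModAbsoluteCircleSplitP03

/-! # `RootDecompRelativeModAbsoluteCircleSplitP04` — part 4/12 of the mechanical ≤400-line split of `csk_min.lean` (sha256 066c56c743abe73e…)
Source: decomp-kz lens-3 g14 CircleSplitK.lean @3d3b9378 (= CircleSplit @d1112051 §0–§25 + §26 kernel split + §27 odd→log; critic CLEARED g6-21 l.1371, g7-2 l.1388) minus the 65 declarations already landed in …CircleLogP1–P11 / …CylLogSplitP46–P49 and minus the 20 superseded g13-glue/tame-class lemmas not on the §26–§27 chain; imports …CylLogSplitP48 + …CircleLogP11; --supports stmt-KontsevichZagierPeriods-30572.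
Split by census-1 g10 `gen/splitlean.py`: scopes re-opened with their `open`/`variable`/`set_option` context; mathematics and declaration order unchanged. -/

noncomputable section
open Set MeasureTheory Filter Topology
open scoped BigOperators
open Literature.NumberTheory.Transcendental Literature.ModelTheory.ExponentialFields
namespace Summit.KontsevichZagierPeriods.RootDecompRelativeModAbsolute.Rung30571.RegularisedLogLayer.CylLog.Leaf
namespace G13
variable {b : ℕ}

/-- `[S] − n•[R] ∈ KZ.relations` when `S = [D, n·f]` and `R = [D, f]` (`n : ℤ`). -/
private theorem of_zsmul_sub_mem_relations {N : ℕ} (n : ℤ) (R S : KZ.IntegralRep N) (hd : S.domain = R.domain)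
    (hi : EqOn S.integrand (fun x => (n : ℝ) * R.integrand x) R.domain) :
    KZ.of S - n • KZ.of R ∈ KZ.relations := by
  -- the honest representation `[D, m·f]`
  let T : ℤ → KZ.IntegralRep N := fun m =>
    { domain := R.domain, integrand := fun x => (m : ℝ) * R.integrand x,
      isSemialgebraic_domain := R.isSemialgebraic_domain,
      isSemialgebraicFunOn_integrand :=
        (IsSemialgebraicFunOn.mul_holds (isSemialgebraicFunOn_ratCast R.isSemialgebraic_domain (m : ℚ))
          R.isSemialgebraicFunOn_integrand).congr fun x _ => by simp,
      integrableOn := R.integrableOn.const_mul (m : ℝ) }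
  have hT : ∀ m : ℤ, KZ.of (T m) - m • KZ.of R ∈ KZ.relations := by
    intro m
    induction m using Int.induction_on with
    | zero =>
      simp only [zero_smul, sub_zero]
      exact KZ.of_mem_relations_of_eqOn_zero (T 0) fun x _ => by simp [T]
    | succ m ih =>
      have h1 : KZ.of (T ((m : ℤ) + 1)) - KZ.of (T m) - KZ.of R ∈ KZ.relations :=
        KZ.integrandAddRel_subset_relations ⟨N, T ((m : ℤ) + 1), T m, R, rfl, rfl, fun x _ => by
          simp only [T, Pi.add_apply]; push_cast; ring, rfl⟩
      have : KZ.of (T ((m : ℤ) + 1)) - ((m : ℤ) + 1) • KZ.of R =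
          (KZ.of (T ((m : ℤ) + 1)) - KZ.of (T m) - KZ.of R) + (KZ.of (T m) - (m : ℤ) • KZ.of R) := by
        rw [add_smul, one_smul]; abel
      rw [this]
      exact KZ.relations.add_mem h1 ih
    | pred m ih =>
      have h1 : KZ.of (T (-(m : ℤ))) - KZ.of (T (-(m : ℤ) - 1)) - KZ.of R ∈ KZ.relations :=
        KZ.integrandAddRel_subset_relations ⟨N, T (-(m : ℤ)), T (-(m : ℤ) - 1), R, rfl, rfl, fun x _ => by
          simp only [T, Pi.add_apply]; push_cast; ring, rfl⟩
      have : KZ.of (T (-(m : ℤ) - 1)) - (-(m : ℤ) - 1) • KZ.of R =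
          (KZ.of (T (-(m : ℤ))) - (-(m : ℤ)) • KZ.of R) - (KZ.of (T (-(m : ℤ))) - KZ.of (T (-(m : ℤ) - 1)) - KZ.of R) := by
        rw [sub_smul, one_smul]; abel
      rw [this]
      exact KZ.relations.sub_mem ih h1
  have h0 : KZ.of S - KZ.of (T n) ∈ KZ.relations :=
    KZ.of_sub_of_mem_relations_of_eqOn (by simp [T, hd]) fun x hx => by
      simp only [T]
      exact hi (hd ▸ hx)
  have : KZ.of S - n • KZ.of R = (KZ.of S - KZ.of (T n)) + (KZ.of (T n) - n • KZ.of R) := by abel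
  rw [this]
  exact KZ.relations.add_mem h0 (hT n)

/-- **Signed consolidation of representations with a common domain**: if `R.integrand = Σ_{l∈s} n_l · (Rs l).integrand`
on the common domain then `[R] − Σ_{l∈s} n_l • [Rs l] ∈ KZ.relations`. -/
private theorem of_sub_sum_zsmul_mem_relations {N : ℕ} {ι : Type*} (s : Finset ι) (Rs : ι → KZ.IntegralRep N) (n : ι → ℤ) :
    ∀ (R : KZ.IntegralRep N), (∀ l ∈ s, (Rs l).domain = R.domain) →
      EqOn R.integrand (fun x => ∑ l ∈ s, (n l : ℝ) * (Rs l).integrand x) R.domain →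
      KZ.of R - ∑ l ∈ s, n l • KZ.of (Rs l) ∈ KZ.relations := by
  classical
  induction s using Finset.induction_on with
  | empty =>
    intro R _ hi
    simp only [Finset.sum_empty, sub_zero] at hi ⊢
    exact KZ.of_mem_relations_of_eqOn_zero R hi
  | insert a s ha ih =>
    intro R hd hi
    have hda : (Rs a).domain = R.domain := hd a (Finset.mem_insert_self a s)
    have hds : ∀ l ∈ s, (Rs l).domain = R.domain := fun l hl => hd l (Finset.mem_insert_of_mem hl)
    -- the partial representation `[D, Σ_{l∈s} n_l f_l]` and the summand `[D, n_a f_a]`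
    let R' : KZ.IntegralRep N :=
      { domain := R.domain, integrand := fun x => ∑ l ∈ s, (n l : ℝ) * (Rs l).integrand x,
        isSemialgebraic_domain := R.isSemialgebraic_domain,
        isSemialgebraicFunOn_integrand := KZ.isSemialgebraicFunOn_finset_sum s R.isSemialgebraic_domain fun l hl =>
          (IsSemialgebraicFunOn.mul_holds (isSemialgebraicFunOn_ratCast R.isSemialgebraic_domain (n l : ℚ))
            (hds l hl ▸ (Rs l).isSemialgebraicFunOn_integrand)).congr fun x _ => by simp,
        integrableOn := integrable_finsetSum s fun l hl =>
          (hds l hl ▸ (Rs l).integrableOn).const_mul (n l : ℝ) }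
    let Sa : KZ.IntegralRep N :=
      { domain := R.domain, integrand := fun x => (n a : ℝ) * (Rs a).integrand x,
        isSemialgebraic_domain := R.isSemialgebraic_domain,
        isSemialgebraicFunOn_integrand :=
          (IsSemialgebraicFunOn.mul_holds (isSemialgebraicFunOn_ratCast R.isSemialgebraic_domain (n a : ℚ))
            (hda ▸ (Rs a).isSemialgebraicFunOn_integrand)).congr fun x _ => by simp,
        integrableOn := (hda ▸ (Rs a).integrableOn).const_mul (n a : ℝ) }
    have h1 : KZ.of R - KZ.of R' - KZ.of Sa ∈ KZ.relations :=
      KZ.integrandAddRel_subset_relations ⟨N, R, R', Sa, rfl, rfl, fun x hx => by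
        rw [hi hx]; simp only [R', Sa, Finset.sum_insert ha, Pi.add_apply]; ring, rfl⟩
    have h2 : KZ.of R' - ∑ l ∈ s, n l • KZ.of (Rs l) ∈ KZ.relations := ih R' hds fun x _ => rfl
    have h3 : KZ.of Sa - n a • KZ.of (Rs a) ∈ KZ.relations :=
      of_zsmul_sub_mem_relations (n a) (Rs a) Sa hda.symm fun x _ => rfl
    rw [Finset.sum_insert ha]
    have : KZ.of R - (n a • KZ.of (Rs a) + ∑ l ∈ s, n l • KZ.of (Rs l)) =
        (KZ.of R - KZ.of R' - KZ.of Sa) + (KZ.of R' - ∑ l ∈ s, n l • KZ.of (Rs l)) +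
          (KZ.of Sa - n a • KZ.of (Rs a)) := by abel
    rw [this]
    exact KZ.relations.add_mem (KZ.relations.add_mem h1 h2) h3

/-- Fibre bound for the reversed regularised kernel by the LOGARITHM (`0 < w ≤ 1`, any order `m`):
`∫⁻_{[w,1]} ‖q (t−1)^m/t‖ ≤ ‖q · log w‖` (since `|t − 1| ≤ 1` on `[w, 1]`). -/
private theorem lintegral_regKernel_le_log' (m : ℕ) (q : ℝ) {w : ℝ} (hw0 : 0 < w) (hw : w ≤ 1) :
    ∫⁻ t in Icc w 1, ‖q * ((t - 1) ^ m / t)‖ₑ ≤ ‖‖q * Real.log w‖‖ₑ := by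
  set g : ℝ → ℝ := fun t => q * ((t - 1) ^ m / t) with hg
  have hg_cont : ContinuousOn g (Icc w 1) := by
    have h := continuousOn_scaled_kernel m q 1 (Icc w 1)
      (fun t ht => (lt_of_lt_of_le hw0 ht.1).ne')
    simpa [hg] using h
  have hg_int : IntegrableOn g (Icc w 1) := hg_cont.integrableOn_compact isCompact_Icc
  have hL : ∫⁻ t in Icc w 1, ‖g t‖ₑ = ENNReal.ofReal (∫ t in Icc w 1, ‖g t‖) :=
    (ofReal_integral_norm_eq_lintegral_enorm hg_int).symm
  show ∫⁻ t in Icc w 1, ‖g t‖ₑ ≤ _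
  rw [hL, Real.enorm_eq_ofReal (norm_nonneg _)]
  refine ENNReal.ofReal_le_ofReal ?_
  have hpt : ∀ t ∈ Icc w 1, ‖g t‖ ≤ |q| * (t : ℝ)⁻¹ := by
    intro t ht
    have ht0 : 0 < t := lt_of_lt_of_le hw0 ht.1
    have h1 : |(t - 1) ^ m| ≤ 1 := by
      rw [abs_pow]
      exact pow_le_one₀ (abs_nonneg _) (by rw [abs_sub_comm, abs_of_nonneg (by linarith [ht.2])]; linarith [ht.1])
    simp only [hg, Real.norm_eq_abs, abs_mul, abs_div, abs_of_pos ht0]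
    rw [div_eq_mul_inv]
    calc |q| * (|(t - 1) ^ m| * t⁻¹) ≤ |q| * (1 * t⁻¹) := by gcongr
      _ = |q| * t⁻¹ := by rw [one_mul]
  have hcont2 : ContinuousOn (fun t : ℝ => |q| * t⁻¹) (Icc w 1) :=
    continuousOn_const.mul (continuousOn_id.inv₀ fun t ht => (lt_of_lt_of_le hw0 ht.1).ne')
  have hint2 : IntegrableOn (fun t : ℝ => |q| * t⁻¹) (Icc w 1) :=
    hcont2.integrableOn_compact isCompact_Icc
  calc ∫ t in Icc w 1, ‖g t‖ ≤ ∫ t in Icc w 1, |q| * t⁻¹ :=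
        setIntegral_mono_on hg_int.norm hint2 measurableSet_Icc hpt
    _ = |q| * (-Real.log w) := by
        rw [integral_Icc_eq_integral_Ioc, ← intervalIntegral.integral_of_le hw,
          intervalIntegral.integral_const_mul, integral_inv_of_pos hw0 one_pos, one_div, Real.log_inv]
    _ = ‖q * Real.log w‖ := by
        rw [norm_mul, Real.norm_eq_abs, Real.norm_eq_abs, abs_of_nonpos (Real.log_nonpos hw0.le hw)]

/-- **Honesty of the reversed regularised cell from the LOG bound** (`0 < W ≤ 1`, any order `m`): for `ℚ`-sa `q, W` on
`G` with `q·log W ∈ L¹(G)`, the cell `[band G W 1, q (t−1)^m/t]` EXISTS as an honest representation.  (Sharper than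
§3o′ `exists_regRep_of_integrableOn_pow'` at the ends where `W → 0`.) -/
private theorem exists_regRep_of_integrableOn_log' {b m : ℕ} {G : Set (Fin b → ℝ)} {q W : (Fin b → ℝ) → ℝ}
    (hG : IsSemialgebraic ℚ G) (hq : IsSemialgebraicFunOn ℚ G q) (hW : IsSemialgebraicFunOn ℚ G W)
    (hW0 : ∀ x ∈ G, 0 < W x) (hW1 : ∀ x ∈ G, W x ≤ 1)
    (hint : IntegrableOn (fun x => q x * Real.log (W x)) G) :
    ∃ R : KZ.IntegralRep (b + 1), R.domain = KZlog.band G W (fun _ => 1) ∧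
      R.integrand = fun z => q (Fin.init z) * ((z (Fin.last b) - 1) ^ m / z (Fin.last b)) := by
  have h1sa : IsSemialgebraicFunOn ℚ G (fun _ => (1:ℝ)) :=
    (isSemialgebraicFunOn_ratCast hG 1).congr fun _ _ => by simp
  have hbsa : IsSemialgebraic ℚ (KZlog.band G W (fun _ => (1:ℝ))) := KZlog.isSemialgebraic_band hW h1sa
  have hGm : MeasurableSet G := hG.measurableSet_holds
  have hBm : MeasurableSet (KZlog.band G W (fun _ => (1:ℝ))) := hbsa.measurableSet_holds
  have hband_sub : KZlog.band G W (fun _ => (1:ℝ)) ⊆ {z : Fin (b + 1) → ℝ | Fin.init z ∈ G} :=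
    fun z hz => hz.1
  have hqI : IsSemialgebraicFunOn ℚ (KZlog.band G W (fun _ => (1:ℝ))) (fun z => q (Fin.init z)) :=
    hq.comp_init.mono hband_sub hbsa
  have hsI : IsSemialgebraicFunOn ℚ (KZlog.band G W (fun _ => (1:ℝ))) (fun z => z (Fin.last b)) :=
    Literature.NumberTheory.Transcendental.isSemialgebraicFunOn_apply hbsa (Fin.last b)
  have hs1 : IsSemialgebraicFunOn ℚ (KZlog.band G W (fun _ => (1:ℝ))) (fun z => z (Fin.last b) - 1) :=
    (IsSemialgebraicFunOn.sub_holds hsI (isSemialgebraicFunOn_ratCast hbsa 1)).congr fun z _ => by simp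
  have hs0 : ∀ z ∈ KZlog.band G W (fun _ => (1:ℝ)), z (Fin.last b) ≠ 0 := fun z hz => by
    have h1 : W (Fin.init z) ≤ z (Fin.last b) := hz.2.1
    exact (lt_of_lt_of_le (hW0 _ hz.1) h1).ne'
  have hRsa : IsSemialgebraicFunOn ℚ (KZlog.band G W (fun _ => (1:ℝ)))
      (fun z => q (Fin.init z) * ((z (Fin.last b) - 1) ^ m / z (Fin.last b))) :=
    IsSemialgebraicFunOn.mul_holds hqI
      (IsSemialgebraicFunOn.div (isSemialgebraicFunOn_pow' hbsa hs1 m) hsI hs0)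
  have hK : IntegrableOn (fun x => ‖q x * Real.log (W x)‖) G := hint.norm
  have hRint : IntegrableOn
      (fun z : Fin (b + 1) → ℝ => q (Fin.init z) * ((z (Fin.last b) - 1) ^ m / z (Fin.last b)))
      (KZlog.band G W (fun _ => (1:ℝ))) := by
    refine KZlog.integrableOn_band_of_lintegral_fibre_le hGm (a := W) (b := fun _ => (1:ℝ)) hBm
      (fun x t => KZlog.snoc_mem_band) (KZ.aestronglyMeasurable_of_isSemialgebraicFunOn hRsa hBm)
      (K := fun x => ‖q x * Real.log (W x)‖) (fun x hx => ?_) hK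
    simp only [Fin.init_snoc, Fin.snoc_last]
    exact lintegral_regKernel_le_log' m (q x) (hW0 x hx) (hW1 x hx)
  exact ⟨{ domain := KZlog.band G W (fun _ => (1:ℝ))
           integrand := fun z => q (Fin.init z) * ((z (Fin.last b) - 1) ^ m / z (Fin.last b))
           isSemialgebraic_domain := hbsa
           isSemialgebraicFunOn_integrand := hRsa
           integrableOn := hRint }, rfl, rfl⟩

/-- Parity bookkeeping for the base terms: `(−1)^{M−1−j} = −(−1)^M (−1)^j` for `j < M`. -/
private theorem neg_one_pow_sub_sub {M j : ℕ} (hj : j < M) : (-1:ℝ) ^ (M - 1 - j) = -((-1) ^ M * (-1) ^ j) := by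
  obtain ⟨n, rfl⟩ : ∃ n, M = n + (j + 1) := ⟨M - 1 - j, by omega⟩
  have hjj : (-1:ℝ) ^ j * (-1) ^ j = 1 := by rw [← mul_pow]; simp
  rw [show n + (j + 1) - 1 - j = n by omega, pow_add, pow_succ]
  linear_combination (-(-1:ℝ) ^ n) * hjj

/-! ### §6b The fibred substitution with INTERIOR positivity (token-identical copy of g12 `G13Rung.lean` §FibreMapVariant =
`RungClosure.lean` v9 BLOCK G13, landing in parallel) and the order-one circle cell → log monomial move `s = 1 + t²`. -/

section FibreMapVariant
open MvPolynomial

example {m : ℕ} {G : Set (Fin m → ℝ)} {a b a' b' : (Fin m → ℝ) → ℝ} (ψ ψs : (Fin (m + 1) → ℝ) → ℝ)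
    (r r' : KZ.IntegralRep (m + 1)) (hr : r.domain = KZlog.band G a b)
    (hr' : r'.domain = KZlog.band G a' b') (hab : ∀ y ∈ G, a y ≤ b y)
    (hψ : IsSemialgebraicFunOn ℚ r.domain ψ) (hψd : ∀ z ∈ r.domain, DifferentiableAt ℝ ψ z)
    (hψs : ∀ z ∈ r.domain, HasDerivAt (fun t : ℝ => ψ (Fin.snoc (Fin.init z) t)) (ψs z) (z (Fin.last m)))
    (hpos : ∀ z ∈ r.domain, 0 < ψs z)
    (ha : ∀ y ∈ G, ψ (Fin.snoc y (a y)) = a' y) (hb : ∀ y ∈ G, ψ (Fin.snoc y (b y)) = b' y)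
    (hint : ∀ z ∈ r.domain, r.integrand z = r'.integrand (Fin.snoc (Fin.init z) (ψ z)) * ψs z) :
    KZ.of r - KZ.of r' ∈ KZ.relations :=
  of_sub_of_mem_relations_of_fibreMap' ψ ψs r r' hr hr' hab hψ hψd hψs (fun z hz _ _ => hpos z hz)
    (fun z hz => (hpos z hz).le) ha hb hint

end FibreMapVariant

/-- **Order-one circle cell → log monomial:** `[band G 0 u, p t/(1+t²)] − [band G 1 (1+u²), (p/2)/s] ∈ KZ.relations`
(rule 2 along `s = 1 + t²`: derivative `2t ≥ 0`, positive on the interior of the fibre). -/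
theorem circOne_sub_logMono_mem_relations {b : ℕ} {G : Set (Fin b → ℝ)} {p u : (Fin b → ℝ) → ℝ}
    (hG : IsSemialgebraic ℚ G) (hu : IsSemialgebraicFunOn ℚ G u) (hu0 : ∀ x ∈ G, 0 ≤ u x)
    (Q L : KZ.IntegralRep (b + 1)) (hQd : Q.domain = KZlog.band G (fun _ => 0) u)
    (hQi : EqOn Q.integrand (fun z => p (Fin.init z) * (z (Fin.last b) / (1 + z (Fin.last b) ^ 2))) Q.domain)
    (hLd : L.domain = KZlog.band G (fun _ => 1) (fun x => 1 + u x ^ 2))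
    (hLi : EqOn L.integrand (fun z => p (Fin.init z) / 2 / z (Fin.last b)) L.domain) :
    KZ.of Q - KZ.of L ∈ KZ.relations := by
  have h0sa : IsSemialgebraicFunOn ℚ G (fun _ => (0:ℝ)) :=
    (isSemialgebraicFunOn_ratCast hG 0).congr fun _ _ => by simp
  have hbsa : IsSemialgebraic ℚ (KZlog.band G (fun _ => (0:ℝ)) u) := KZlog.isSemialgebraic_band h0sa hu
  refine of_sub_of_mem_relations_of_fibreMap' (a := fun _ => 0) (b := u) (a' := fun _ => 1)
    (b' := fun x => 1 + u x ^ 2) (fun z => 1 + z (Fin.last b) ^ 2) (fun z => 2 * z (Fin.last b)) Q L hQd hLd hu0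
    ?_ ?_ ?_ ?_ ?_ ?_ ?_ ?_
  · rw [hQd]
    exact IsSemialgebraicFunOn.add_holds ((isSemialgebraicFunOn_ratCast hbsa 1).congr fun _ _ => by simp)
      (isSemialgebraicFunOn_pow' hbsa (Literature.NumberTheory.Transcendental.isSemialgebraicFunOn_apply hbsa (Fin.last b)) 2)
  · intro z _
    fun_prop
  · intro z _
    show HasDerivAt (fun t : ℝ => 1 + (Fin.snoc (Fin.init z) t : Fin (b + 1) → ℝ) (Fin.last b) ^ 2)
      (2 * z (Fin.last b)) (z (Fin.last b))
    simp only [Fin.snoc_last]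
    exact ((hasDerivAt_pow 2 (z (Fin.last b))).const_add 1).congr_deriv (by norm_num)
  · intro z _ h0 _
    have h0' : (0:ℝ) < z (Fin.last b) := h0
    positivity
  · intro z hz
    rw [hQd] at hz
    have h0' : (0:ℝ) ≤ z (Fin.last b) := hz.2.1
    positivity
  · intro y _
    simp
  · intro y _
    simp
  · intro z hz
    have hz' : z ∈ KZlog.band G (fun _ => (0:ℝ)) u := hQd ▸ hz
    obtain ⟨hx, h0, h1⟩ := hz'
    have h0' : (0:ℝ) ≤ z (Fin.last b) := h0
    have h1' : z (Fin.last b) ≤ u (Fin.init z) := h1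
    have hmem : (Fin.snoc (Fin.init z) (1 + z (Fin.last b) ^ 2) : Fin (b + 1) → ℝ) ∈ L.domain := by
      rw [hLd, KZlog.snoc_mem_band]
      refine ⟨hx, ?_, ?_⟩
      · show (1:ℝ) ≤ 1 + z (Fin.last b) ^ 2
        nlinarith
      · show 1 + z (Fin.last b) ^ 2 ≤ 1 + u (Fin.init z) ^ 2
        nlinarith
    rw [hQi hz, hLi hmem]
    simp only [Fin.init_snoc, Fin.snoc_last]
    have : 1 + z (Fin.last b) ^ 2 ≠ 0 := by positivity
    field_simp

/-! ### §7 THE TAME CLASS CLOSES — `CircleBoundaryRigidity → CellCloseCSTame` (the circle twin of g11 `tameClose` /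
`cellCloseLS_tame`).  §7a fibre majorants for the lower circle cells and the two-log-family form of (R1ᶜ). -/

/-- `∫₀ᵘ dt/(1+t²) ≤ arctan u`. -/
theorem integral_circKernel_zero_le_arctan {u : ℝ} (hu : 0 ≤ u) :
    ∫ t in Icc 0 u, t ^ 0 / (1 + t ^ 2) ≤ Real.arctan u := by
  rw [integral_Icc_eq_integral_Ioc, ← intervalIntegral.integral_of_le hu]
  simp only [pow_zero, one_div]
  rw [integral_inv_one_add_sq, Real.arctan_zero, sub_zero]

/-- `∫₀ᵘ t dt/(1+t²) ≤ log(1+u²)/2`. -/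
theorem integral_circKernel_one_le_log {u : ℝ} (hu : 0 ≤ u) :
    ∫ t in Icc 0 u, t ^ 1 / (1 + t ^ 2) ≤ Real.log (1 + u ^ 2) / 2 := by
  rw [integral_Icc_eq_integral_Ioc, ← intervalIntegral.integral_of_le hu]
  have hderiv : ∀ t ∈ Set.uIcc 0 u,
      HasDerivAt (fun t => Real.log (1 + t ^ 2) / 2) (t ^ 1 / (1 + t ^ 2)) t := by
    intro t _
    have h1 : (0:ℝ) < 1 + t ^ 2 := by positivity
    have h2 : HasDerivAt (fun x : ℝ => 1 + x ^ 2) (2 * t) t :=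
      ((hasDerivAt_pow 2 t).const_add 1).congr_deriv (by norm_num)
    have h3 := (h2.log h1.ne').div_const 2
    exact h3.congr_deriv (by rw [pow_one]; ring)
  have hcont : Continuous (fun t : ℝ => t ^ 1 / (1 + t ^ 2)) :=
    Continuous.div (by fun_prop) (by fun_prop) fun t => by positivity
  rw [intervalIntegral.integral_eq_sub_of_hasDerivAt hderiv (hcont.intervalIntegrable _ _)]
  simp

/-- `∫₀ᵘ t^{m+2} dt/(1+t²) ≤ u^{m+1}/(m+1)`. -/
theorem integral_circKernel_le_pow (m : ℕ) {u : ℝ} (hu : 0 ≤ u) :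
    ∫ t in Icc 0 u, t ^ (m + 2) / (1 + t ^ 2) ≤ u ^ (m + 1) / ((m : ℝ) + 1) := by
  rw [integral_Icc_eq_integral_Ioc, ← intervalIntegral.integral_of_le hu]
  have hle : ∀ t ∈ Set.Icc 0 u, t ^ (m + 2) / (1 + t ^ 2) ≤ t ^ m := by
    intro t ht
    rw [div_le_iff₀ (by positivity), pow_add]
    nlinarith [pow_nonneg ht.1 m]
  have hc1 : Continuous (fun t : ℝ => t ^ (m + 2) / (1 + t ^ 2)) :=
    Continuous.div (by fun_prop) (by fun_prop) fun t => by positivity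
  have hc2 : Continuous (fun t : ℝ => t ^ m) := by fun_prop
  calc ∫ t in (0:ℝ)..u, t ^ (m + 2) / (1 + t ^ 2)
      ≤ ∫ t in (0:ℝ)..u, t ^ m :=
        intervalIntegral.integral_mono_on hu (hc1.intervalIntegrable _ _) (hc2.intervalIntegrable _ _) hle
    _ = u ^ (m + 1) / ((m : ℝ) + 1) := by
        rw [integral_pow]
        simp

end G13
end Summit.KontsevichZagierPeriods.RootDecompRelativeModAbsolute.Rung30571.RegularisedLogLayer.CylLog.Leaf
end
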